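import Literature.Probability.LatticeModels.LineTouchingIO
import Literature.Probability.LatticeModels.ButterflyLemma
import Literature.Probability.LatticeModels.StarZhangCrossing
import Literature.Probability.Percolation.StarWindingBands
import HarnessLib

/-!
# Sides and uniqueness of the semi-infinite clusters (Georgii–Higuchi 2000, Lemma 4.1 and §5)

Topic `Probability/LatticeModels`; theorems only. Georgii–Higuchi, J. Math. Phys. 41 (2000):
Lemma 4.1, first statement — "For any half-plane `π`, there exists `𝒢`-almost surely at most one
infinite `+` (resp. `+∗`) cluster in `π`", proved (p. 11, *Uniqueness*) from the line touching
property: "this `I^{-∗}_up` meets `ℓ_left` or `ℓ_right` infinitely often, so that each infinite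
`+`cluster must meet the other half-line infinitely often. Hence, two such `+`clusters must cross
each other, and are thus identical"; and the standing set-up of §5 (proof of Lemma 5.3): "Let
`I^{+∗}_up` be the unique infinite `+∗`cluster in `π_up`, and `I^-_up` the unique infinite `-`cluster in
`π_up` … `I^{+∗}_up` meets `ℓ_right` infinitely often, and `I^-_up` meets `ℓ_left` infinitely often."

We prove these facts for the upper half-plane `π_up = {x₂ ≥ 0}` in the coexistence situation of
§5 (an infinite `+∗`cluster and an infinite `-`cluster of `π_up`), where only the matching-pair
crossing property "a `-`path cannot traverse a `+∗`path" is needed, in the form of the tree's eye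
lemma (`Percolation.StarWindingBands`) applied to a `∗`-walk of `π_up` between two sites of the axis
together with its mirror image (Georgii–Higuchi's `R`-invariant `∗`circuit `c = σ ∪ R(σ)`, p. 7):

* `finite_or_meets_of_between`, `finite_or_touches_of_between` — **trap lemmas**: a lattice
  (resp. `∗`-) cluster of a subset of `π_up` through `(t₂, 0)` is finite unless it meets (resp.
  touches) a given `∗`-walk of `π_up` from `(t₃, 0)` to `(t₁, 0)`, `t₃ < t₂ < t₁`;
* `plusStar_minus_sides` — **sides**: for an infinite `+∗`cluster `D` of `π_up` touching the axis
  outside every box and an infinite `-`cluster `C` of `π_up` with an axis site, either every axis site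
  of `D` lies strictly to the left of every axis site of `C`, or strictly to the right;
* `minus_cluster_unique`, `plusStar_cluster_unique` — **uniqueness** of the infinite `-`cluster and of
  the infinite `+∗`cluster of `π_up` when both kinds exist and touch the axis outside every box
  (Lemma 4.1, *Uniqueness*, second case);
* `ae_minus_touches_axis_io` — the line touching lemma for `-`clusters (spin flip of the tree's
  `ae_infinite_cluster_touches_axis_io`), and the almost-sure forms `ae_plusStar_minus_sides`,
  `ae_minus_cluster_unique`, `ae_plusStar_cluster_unique` for `β > β_c(2)` and every `μ ∈ 𝒢(β, 0)`.

## References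

* H.-O. Georgii, Y. Higuchi, J. Math. Phys. 41 (2000) 1153–1169, Lemma 4.1 and its proof (p. 11),
  proof of Lemma 5.3 (p. 13) [GeorgiiHiguchi2000].
* H. Kesten, *Percolation theory for mathematicians*, Birkhäuser 1982, §2.2 (matching pairs).
-/

noncomputable section

open MeasureTheory Filter SimpleGraph
open Literature.Probability.Percolation
open scoped ENNReal

namespace Literature.Probability.LatticeModels

/-! ### Walks and clusters: bookkeeping -/

section Walks

variable {V : Type*} {G : SimpleGraph V}

/-- Two sites of the same site cluster are joined by a walk of `G` inside the open set. [folklore] -/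
theorem exists_walk_of_mem_siteCluster {O : Set V} {x a b : V} (ha : a ∈ siteCluster G O x)
    (hb : b ∈ siteCluster G O x) : ∃ p : G.Walk a b, ∀ z ∈ p.support, z ∈ O := by
  obtain ⟨-, haO, hxa⟩ := ha
  obtain ⟨-, -, hxb⟩ := hb
  obtain ⟨q⟩ := hxa.symm.trans hxb
  have hle : siteOpenGraph G O ≤ G := fun u v huv => ((siteOpenGraph_adj _ _ _ _).1 huv).1
  refine ⟨q.mapLe hle, fun z hz => ?_⟩
  rw [Walk.support_mapLe_eq_support] at hz
  exact support_subset_of_walk_siteOpenGraph q haO z hz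

/-- A site joined inside `O` to a site of a cluster belongs to the cluster. [folklore] -/
theorem mem_siteCluster_of_walk {O : Set V} {x a b : V} (ha : a ∈ siteCluster G O x) (p : G.Walk a b)
    (hp : ∀ z ∈ p.support, z ∈ O) : b ∈ siteCluster G O x :=
  ⟨ha.1, hp b (Walk.end_mem_support p), ha.2.2.trans (siteOpenGraph_reachable_of_walk p hp)⟩

/-- Every vertex of a walk inside `O` from a site of a cluster belongs to the cluster. [folklore] -/
theorem mem_siteCluster_of_mem_support [DecidableEq V] {O : Set V} {x a b : V} (ha : a ∈ siteCluster G O x)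
    (p : G.Walk a b) (hp : ∀ z ∈ p.support, z ∈ O) {z : V} (hz : z ∈ p.support) : z ∈ siteCluster G O x :=
  mem_siteCluster_of_walk ha (p.takeUntil z hz) fun w hw => hp w (p.support_takeUntil_subset_support hz hw)

/-- Two site clusters with a common site coincide. [folklore] -/
theorem siteCluster_eq_of_mem {O : Set V} {x₁ x₂ z : V} (h₁ : z ∈ siteCluster G O x₁) (h₂ : z ∈ siteCluster G O x₂) :
    siteCluster G O x₁ = siteCluster G O x₂ := by
  ext w
  constructor
  · intro hw; exact ⟨h₂.1, hw.2.1, (h₂.2.2.trans h₁.2.2.symm).trans hw.2.2⟩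
  · intro hw; exact ⟨h₁.1, hw.2.1, (h₁.2.2.trans h₂.2.2.symm).trans hw.2.2⟩

end Walks

/-! ### The trap lemmas -/

section Trap

/-- The site `(k, 0)` of the horizontal axis, coordinates. [folklore] -/
theorem axis_apply (k : ℤ) : (![k, 0] : Site 2) 0 = k ∧ (![k, 0] : Site 2) 1 = 0 := by simp

/-- A site of the axis is `(k, 0)` with `k` its abscissa. [folklore] -/
theorem eq_axis_of_apply_one {z : Site 2} (hz : z 1 = 0) : z = ![z 0, 0] := by
  funext j; fin_cases j <;> simp [hz]

/-- The reflection in the horizontal axis fixes the axis pointwise. [cite: GeorgiiHiguchi2000, §2 p. 3] -/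
theorem reflectCoord_one_eq_self_of_apply_one {z : Site 2} (hz : z 1 = 0) : reflectCoord 1 z = z := by
  funext j
  rw [reflectCoord_apply]
  fin_cases j <;> simp [hz]

/-- Second coordinate of the reflected site. [cite: GeorgiiHiguchi2000, §2 p. 3] -/
theorem reflectCoord_one_apply_one (z : Site 2) : reflectCoord 1 z 1 = -z 1 := by
  rw [reflectCoord_apply, if_pos rfl]

/-- First coordinate of the reflected site. [cite: GeorgiiHiguchi2000, §2 p. 3] -/
theorem reflectCoord_one_apply_zero (z : Site 2) : reflectCoord 1 z 0 = z 0 := by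
  rw [reflectCoord_apply, if_neg (by decide)]

/-- **Mirror image of a `∗`-walk between two sites of the axis** (Georgii–Higuchi's `c = σ ∪ R(σ)`,
proof of Lemma 3.1, Step 1, p. 7). [cite: GeorgiiHiguchi2000, Lemma 3.1 (proof, Step 1, p. 7)] -/
theorem exists_reflected_starWalk {a b : ℤ} (α : zdStarGraph.Walk (![a, 0] : Site 2) (![b, 0])) :
    ∃ α' : zdStarGraph.Walk (![a, 0] : Site 2) (![b, 0]), ∀ z, z ∈ α'.support ↔ reflectCoord 1 z ∈ α.support := by
  have ha : reflectCoord 1 (![a, 0] : Site 2) = ![a, 0] := reflectCoord_one_eq_self_of_apply_one (by simp)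
  have hb : reflectCoord 1 (![b, 0] : Site 2) = ![b, 0] := reflectCoord_one_eq_self_of_apply_one (by simp)
  refine ⟨(α.map (starReflectHom 1)).copy ha hb, fun z => ?_⟩
  rw [Walk.support_copy, Walk.support_map, List.mem_map]
  constructor
  · rintro ⟨y, hy, rfl⟩
    rw [starReflectHom_apply, reflectCoord_reflectCoord]; exact hy
  · intro hz
    exact ⟨reflectCoord 1 z, hz, by rw [starReflectHom_apply, reflectCoord_reflectCoord]⟩

/-- The hypotheses of the eye lemma for `q ∪ R(q)` with the window `{(t₂, 0)}`. [cite: GeorgiiHiguchi2000, Lemma 4.1 (proof, p. 11)] -/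
theorem eye_hypotheses {t₃ t₂ t₁ : ℤ} (q : zdStarGraph.Walk (![t₃, 0] : Site 2) (![t₁, 0]))
    (hq : ∀ z ∈ q.support, 0 ≤ z 1) (ht₂ : (![t₂, 0] : Site 2) ∉ q.support)
    (q' : zdStarGraph.Walk (![t₃, 0] : Site 2) (![t₁, 0])) (hq' : ∀ z, z ∈ q'.support ↔ reflectCoord 1 z ∈ q.support) :
    (∀ z ∈ q.support, ¬ (t₂ ≤ z 0 ∧ z 0 ≤ t₂ ∧ z 1 ≤ ((0 : ℕ) : ℤ))) ∧
      (∀ z ∈ q'.support, ¬ (t₂ ≤ z 0 ∧ z 0 ≤ t₂ ∧ -((0 : ℕ) : ℤ) ≤ z 1)) := by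
  constructor
  · rintro z hz ⟨h1, h2, h3⟩
    have hz1 : z 1 = 0 := le_antisymm (by exact_mod_cast h3) (hq z hz)
    have : z = ![t₂, 0] := by
      rw [eq_axis_of_apply_one hz1]
      have : z 0 = t₂ := le_antisymm h2 h1
      rw [this]
    exact ht₂ (this ▸ hz)
  · rintro z hz ⟨h1, h2, h3⟩
    have hRz := (hq' z).1 hz
    have hz1' : 0 ≤ (reflectCoord 1 z) 1 := hq _ hRz
    rw [reflectCoord_one_apply_one] at hz1'
    have hz1 : z 1 = 0 := by push_cast at h3; omega
    rw [reflectCoord_one_eq_self_of_apply_one hz1] at hRz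
    have : z = ![t₂, 0] := by
      rw [eq_axis_of_apply_one hz1]
      have : z 0 = t₂ := le_antisymm h2 h1
      rw [this]
    exact ht₂ (this ▸ hRz)

/-- **Trap lemma, lattice clusters** (the crossing argument "two such clusters must cross each other"
of Georgii–Higuchi 2000, proof of Lemma 4.1, *Uniqueness*, p. 11, via the `R`-invariant `∗`circuit
`q ∪ R(q)` and the eye lemma): let `q` be a `∗`-walk of the upper half-plane from `(t₃, 0)` to
`(t₁, 0)` not passing through `(t₂, 0)`, `t₃ < t₂ < t₁`, and `O ⊆ π_up`; then the lattice cluster of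
`O` through `(t₂, 0)` is finite or contains a vertex of `q`. [cite: GeorgiiHiguchi2000, Lemma 4.1 (proof, p. 11)] -/
theorem finite_or_meets_of_between {t₃ t₂ t₁ : ℤ} (h₃₂ : t₃ < t₂) (h₂₁ : t₂ < t₁)
    (q : zdStarGraph.Walk (![t₃, 0] : Site 2) (![t₁, 0])) (hq : ∀ z ∈ q.support, 0 ≤ z 1)
    (ht₂ : (![t₂, 0] : Site 2) ∉ q.support) {O : Set (Site 2)} (hO : O ⊆ halfPlane 0) {y : Site 2}
    (hy : (![t₂, 0] : Site 2) ∈ siteCluster (zdGraph 2) O y) :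
    (siteCluster (zdGraph 2) O y).Finite ∨ ∃ z ∈ siteCluster (zdGraph 2) O y, z ∈ q.support := by
  classical
  obtain ⟨q', hq'⟩ := exists_reflected_starWalk q
  obtain ⟨H, hH⟩ := (eventually_subset_box_holds (d := 2) (q.support.toFinset ∪ q'.support.toFinset)).exists
  have hHq : ∀ z ∈ q.support, z ∈ box 2 H := fun z hz => hH (Finset.mem_union_left _ (List.mem_toFinset.2 hz))
  have hHq' : ∀ z ∈ q'.support, z ∈ box 2 H := fun z hz => hH (Finset.mem_union_right _ (List.mem_toFinset.2 hz))
  rw [or_iff_not_imp_left]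
  intro hinf
  rw [Set.not_finite] at hinf
  obtain ⟨c, hc, hcH⟩ := hinf.exists_notMem_finset (box 2 H)
  obtain ⟨β, hβ⟩ := exists_walk_of_mem_siteCluster hy hc
  obtain ⟨hα, hα'⟩ := eye_hypotheses q hq ht₂ q' hq'
  have hu : t₂ ≤ (![t₂, 0] : Site 2) 0 ∧ (![t₂, 0] : Site 2) 0 ≤ t₂ ∧
      -((0 : ℕ) : ℤ) ≤ (![t₂, 0] : Site 2) 1 ∧ (![t₂, 0] : Site 2) 1 ≤ ((0 : ℕ) : ℤ) := by simp
  obtain ⟨z, hzβ, hz⟩ := exists_mem_support_of_bandSemicircuits (m := 0) h₃₂ h₂₁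
    (axis_apply t₃).1 (axis_apply t₃).2 (axis_apply t₁).1 (axis_apply t₁).2 q hα q' hα' hHq hHq' hu hcH β
  have hzC : z ∈ siteCluster (zdGraph 2) O y := mem_siteCluster_of_mem_support hy β hβ hzβ
  refine ⟨z, hzC, ?_⟩
  rcases hz with hz | hz
  · exact hz
  · have hRz := (hq' z).1 hz
    have h1 : 0 ≤ (reflectCoord 1 z) 1 := hq _ hRz
    rw [reflectCoord_one_apply_one] at h1
    have h2 : 0 ≤ z 1 := hO (hβ z hzβ)
    have hz1 : z 1 = 0 := by omega
    rwa [reflectCoord_one_eq_self_of_apply_one hz1] at hRz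

/-- **Trap lemma, `∗`-clusters**: in the situation of `finite_or_meets_of_between`, the `∗`-cluster of
`O` through `(t₂, 0)` is finite or has a vertex equal or lattice-adjacent to a vertex of `q`
(eye lemma for `∗`-escape walks). [cite: GeorgiiHiguchi2000, Lemma 4.1 (proof, p. 11)] -/
theorem finite_or_touches_of_between {t₃ t₂ t₁ : ℤ} (h₃₂ : t₃ < t₂) (h₂₁ : t₂ < t₁)
    (q : zdStarGraph.Walk (![t₃, 0] : Site 2) (![t₁, 0])) (hq : ∀ z ∈ q.support, 0 ≤ z 1)
    (ht₂ : (![t₂, 0] : Site 2) ∉ q.support) {O : Set (Site 2)} (hO : O ⊆ halfPlane 0) {y : Site 2}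
    (hy : (![t₂, 0] : Site 2) ∈ siteCluster zdStarGraph O y) :
    (siteCluster zdStarGraph O y).Finite ∨
      ∃ w ∈ q.support, ∃ z' ∈ siteCluster zdStarGraph O y, w = z' ∨ (zdGraph 2).Adj w z' := by
  classical
  obtain ⟨q', hq'⟩ := exists_reflected_starWalk q
  obtain ⟨H, hH⟩ := (eventually_subset_box_holds (d := 2) (q.support.toFinset ∪ q'.support.toFinset)).exists
  have hHq : ∀ z ∈ q.support, z ∈ box 2 H := fun z hz => hH (Finset.mem_union_left _ (List.mem_toFinset.2 hz))
  have hHq' : ∀ z ∈ q'.support, z ∈ box 2 H := fun z hz => hH (Finset.mem_union_right _ (List.mem_toFinset.2 hz))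
  rw [or_iff_not_imp_left]
  intro hinf
  rw [Set.not_finite] at hinf
  obtain ⟨c, hc, hcH⟩ := hinf.exists_notMem_finset (box 2 H)
  obtain ⟨β, hβ⟩ := exists_walk_of_mem_siteCluster hy hc
  obtain ⟨hα, hα'⟩ := eye_hypotheses q hq ht₂ q' hq'
  have hu : t₂ ≤ (![t₂, 0] : Site 2) 0 ∧ (![t₂, 0] : Site 2) 0 ≤ t₂ ∧
      -((0 : ℕ) : ℤ) ≤ (![t₂, 0] : Site 2) 1 ∧ (![t₂, 0] : Site 2) 1 ≤ ((0 : ℕ) : ℤ) := by simp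
  obtain ⟨z, hz, z', hz'β, hzz'⟩ := exists_touch_of_bandSemicircuits (m := 0) h₃₂ h₂₁
    (axis_apply t₃).1 (axis_apply t₃).2 (axis_apply t₁).1 (axis_apply t₁).2 q hα q' hα' hHq hHq' hu hcH β
  have hz'C : z' ∈ siteCluster zdStarGraph O y := mem_siteCluster_of_mem_support hy β hβ hz'β
  have hz'1 : 0 ≤ z' 1 := hO (hβ z' hz'β)
  rcases hz with hz | hz
  · exact ⟨z, hz, z', hz'C, hzz'⟩
  · -- `z ∈ R(q)`: bring it back to `q`
    have hRz := (hq' z).1 hz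
    have h1 : 0 ≤ (reflectCoord 1 z) 1 := hq _ hRz
    rw [reflectCoord_one_apply_one] at h1
    rcases hzz' with rfl | hadj
    · have hz1 : z 1 = 0 := by omega
      rw [reflectCoord_one_eq_self_of_apply_one hz1] at hRz
      exact ⟨z, hRz, z, hz'C, Or.inl rfl⟩
    · rw [zdGraph_adj_iff] at hadj
      obtain ⟨i, hi⟩ := hadj
      -- `z` and `z'` differ by a unit vector in the coordinate `i`
      by_cases hz1 : z 1 = 0
      · rw [reflectCoord_one_eq_self_of_apply_one hz1] at hRz
        exact ⟨z, hRz, z', hz'C, Or.inr (by rw [zdGraph_adj_iff]; exact ⟨i, hi⟩)⟩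
      · -- then `z 1 = -1`, `z' 1 = 0`, `z' 0 = z 0`, and `R z = z' + e₂`
        have hcoords : ∀ j, z' j = z j + (if j = i then (1 : ℤ) else 0) ∨ z' j = z j - (if j = i then (1 : ℤ) else 0) := by
          intro j
          rcases hi with h | h
          · left; have := congrFun h j; simp only [Pi.add_apply, Pi.single_apply] at this; rw [this]
          · right; have := congrFun h j; simp only [Pi.add_apply, Pi.single_apply] at this; rw [this]; ring
        have h1' := hcoords 1
        have h0' := hcoords 0
        refine ⟨reflectCoord 1 z, hRz, z', hz'C, Or.inr ?_⟩
        rw [zdGraph_adj_iff]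
        refine ⟨1, Or.inr ?_⟩
        funext j
        fin_cases j
        · simp only [Fin.zero_eta, Pi.add_apply, reflectCoord_one_apply_zero, Pi.single_apply]
          fin_cases i <;> simp at h0' h1' ⊢ <;> omega
        · simp only [Fin.mk_one, Pi.add_apply, reflectCoord_one_apply_one, Pi.single_apply]
          fin_cases i <;> simp at h0' h1' ⊢ <;> omega

end Trap

/-! ### Sides of a `+∗`cluster and a `-`cluster of the upper half-plane -/

section Sides

variable {ω : SpinConfig (Site 2)} {x y : Site 2}

/-- A `+` site is not a `-` site. [folklore] -/
theorem spin_ne {z : Site 2} (h1 : ω z = 1) (h2 : ω z = -1) : False := by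
  rw [h1] at h2; exact absurd h2 (by decide)

/-- **No axis site of an infinite `-`cluster between two axis sites of a `+∗`cluster** (trap lemma
with the `+∗`walk of the cluster between them). [cite: GeorgiiHiguchi2000, Lemma 4.1 (proof, p. 11)] -/
theorem not_between_of_infinite {a b k : ℤ}
    (ha : (![a, 0] : Site 2) ∈ siteCluster zdStarGraph (spinSites 1 ω ∩ halfPlane 0) x)
    (hb : (![b, 0] : Site 2) ∈ siteCluster zdStarGraph (spinSites 1 ω ∩ halfPlane 0) x)
    (hk : (![k, 0] : Site 2) ∈ siteCluster (zdGraph 2) (spinSites (-1) ω ∩ halfPlane 0) y)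
    (hinf : (siteCluster (zdGraph 2) (spinSites (-1) ω ∩ halfPlane 0) y).Infinite) : ¬ (a < k ∧ k < b) := by
  rintro ⟨hak, hkb⟩
  obtain ⟨q, hq⟩ := exists_walk_of_mem_siteCluster ha hb
  have hkq : (![k, 0] : Site 2) ∉ q.support := fun h => spin_ne (hq _ h).1 hk.2.1.1
  rcases finite_or_meets_of_between hak hkb q (fun z hz => (hq z hz).2) hkq Set.inter_subset_right hk with hfin | ⟨z, hzC, hzq⟩
  · exact hinf hfin
  · exact spin_ne (hq z hzq).1 hzC.2.1.1

/-- Axis sites of a cluster touching the axis outside every box: for every `n` there is an axis site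
`(a, 0)` of the cluster with `|a| > n`. [folklore] -/
theorem exists_axis_far {G : SimpleGraph (Site 2)} {O : Set (Site 2)} {x : Site 2}
    (h : ∀ n : ℕ, ∃ z ∈ siteCluster G O x, z 1 = 0 ∧ (n : ℤ) < |z 0|) (n : ℕ) :
    ∃ a : ℤ, (![a, 0] : Site 2) ∈ siteCluster G O x ∧ (n : ℤ) < |a| := by
  obtain ⟨z, hz, hz1, hzn⟩ := h n
  exact ⟨z 0, by rw [← eq_axis_of_apply_one hz1]; exact hz, hzn⟩

/-- **Sides** (Georgii–Higuchi 2000, §5, set-up of Lemma 5.3: "`I^{+∗}_up` meets `ℓ_right` infinitely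
often, and `I^-_up` meets `ℓ_left` infinitely often", or the mirror situation): if a `+∗`cluster `D` of
the upper half-plane touches the axis outside every box and `C` is an infinite `-`cluster of the upper
half-plane with an axis site, then either all axis sites of `D` lie strictly to the left of all axis
sites of `C`, or all lie strictly to the right. [cite: GeorgiiHiguchi2000, Lemma 5.3 (proof, p. 13)] -/
theorem plusStar_minus_sides
    (hD : ∀ n : ℕ, ∃ z ∈ siteCluster zdStarGraph (spinSites 1 ω ∩ halfPlane 0) x, z 1 = 0 ∧ (n : ℤ) < |z 0|)
    (hC : (siteCluster (zdGraph 2) (spinSites (-1) ω ∩ halfPlane 0) y).Infinite)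
    (hC0 : ∃ k : ℤ, (![k, 0] : Site 2) ∈ siteCluster (zdGraph 2) (spinSites (-1) ω ∩ halfPlane 0) y) :
    (∀ a k : ℤ, (![a, 0] : Site 2) ∈ siteCluster zdStarGraph (spinSites 1 ω ∩ halfPlane 0) x →
        (![k, 0] : Site 2) ∈ siteCluster (zdGraph 2) (spinSites (-1) ω ∩ halfPlane 0) y → a < k) ∨
      (∀ a k : ℤ, (![a, 0] : Site 2) ∈ siteCluster zdStarGraph (spinSites 1 ω ∩ halfPlane 0) x →
        (![k, 0] : Site 2) ∈ siteCluster (zdGraph 2) (spinSites (-1) ω ∩ halfPlane 0) y → k < a) := by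
  have hne : ∀ {a k : ℤ}, (![a, 0] : Site 2) ∈ siteCluster zdStarGraph (spinSites 1 ω ∩ halfPlane 0) x →
      (![k, 0] : Site 2) ∈ siteCluster (zdGraph 2) (spinSites (-1) ω ∩ halfPlane 0) y → a ≠ k := by
    rintro a k ha hk rfl
    exact spin_ne ha.2.1.1 hk.2.1.1
  obtain ⟨k₀, hk₀⟩ := hC0
  by_cases hup : ∃ M : ℤ, ∀ a : ℤ, (![a, 0] : Site 2) ∈ siteCluster zdStarGraph (spinSites 1 ω ∩ halfPlane 0) x → a ≤ M
  · -- `D` bounded above on the axis, hence unbounded below: `D` is to the left of `C`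
    obtain ⟨M, hM⟩ := hup
    have hdown : ∀ n : ℤ, ∃ a : ℤ, (![a, 0] : Site 2) ∈ siteCluster zdStarGraph (spinSites 1 ω ∩ halfPlane 0) x ∧ a < n := by
      intro n
      obtain ⟨a, ha, han⟩ := exists_axis_far hD (n.natAbs + M.natAbs)
      refine ⟨a, ha, ?_⟩
      have := hM a ha
      cases abs_cases a <;> omega
    left
    intro a k ha hk
    by_contra hle
    have := hne ha hk
    obtain ⟨a', ha', ha'k⟩ := hdown k
    exact not_between_of_infinite ha' ha hk hC ⟨ha'k, by omega⟩
  · push Not at hup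
    by_cases hlow : ∃ m : ℤ, ∀ a : ℤ, (![a, 0] : Site 2) ∈ siteCluster zdStarGraph (spinSites 1 ω ∩ halfPlane 0) x → m ≤ a
    · -- `D` bounded below on the axis and unbounded above: `D` is to the right of `C`
      right
      intro a k ha hk
      by_contra hle
      have := hne ha hk
      obtain ⟨a', ha', hka'⟩ := hup k
      exact not_between_of_infinite ha ha' hk hC ⟨by omega, hka'⟩
    · -- unbounded on both sides: impossible
      exfalso
      push Not at hlow
      obtain ⟨a, ha, hka⟩ := hup k₀
      obtain ⟨a', ha', ha'k⟩ := hlow k₀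
      exact not_between_of_infinite ha' ha hk₀ hC ⟨ha'k, hka⟩

end Sides

/-! ### Uniqueness -/

section Unique

variable {ω : SpinConfig (Site 2)}

/-- **Uniqueness of the infinite `-`cluster of the upper half-plane in the presence of a `+∗`cluster
touching the axis outside every box** (Georgii–Higuchi 2000, Lemma 4.1, *Uniqueness*, second case, with
the signs exchanged): two infinite `-`clusters of `π_up` touching the axis outside every box lie on the
same side of the `+∗`cluster, so their axis sites interlace and the clusters cross, hence coincide. [cite: GeorgiiHiguchi2000, Lemma 4.1 (proof, p. 11)] -/
theorem minus_cluster_unique {x y₁ y₂ : Site 2}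
    (hD : ∀ n : ℕ, ∃ z ∈ siteCluster zdStarGraph (spinSites 1 ω ∩ halfPlane 0) x, z 1 = 0 ∧ (n : ℤ) < |z 0|)
    (hC₁ : (siteCluster (zdGraph 2) (spinSites (-1) ω ∩ halfPlane 0) y₁).Infinite)
    (hC₁t : ∀ n : ℕ, ∃ z ∈ siteCluster (zdGraph 2) (spinSites (-1) ω ∩ halfPlane 0) y₁, z 1 = 0 ∧ (n : ℤ) < |z 0|)
    (hC₂ : (siteCluster (zdGraph 2) (spinSites (-1) ω ∩ halfPlane 0) y₂).Infinite)
    (hC₂t : ∀ n : ℕ, ∃ z ∈ siteCluster (zdGraph 2) (spinSites (-1) ω ∩ halfPlane 0) y₂, z 1 = 0 ∧ (n : ℤ) < |z 0|) :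
    siteCluster (zdGraph 2) (spinSites (-1) ω ∩ halfPlane 0) y₁ =
      siteCluster (zdGraph 2) (spinSites (-1) ω ∩ halfPlane 0) y₂ := by
  set O := spinSites (-1) ω ∩ halfPlane 0 with hOdef
  -- crossing: interlaced axis sites `c < c' < c''` of `C₁, C₂, C₁` give a common site
  have hcross : ∀ {w₁ w₂ : Site 2} {c c' c'' : ℤ}, c < c' → c' < c'' →
      (siteCluster (zdGraph 2) O w₂).Infinite →
      (![c, 0] : Site 2) ∈ siteCluster (zdGraph 2) O w₁ → (![c'', 0] : Site 2) ∈ siteCluster (zdGraph 2) O w₁ →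
      (![c', 0] : Site 2) ∈ siteCluster (zdGraph 2) O w₂ →
      siteCluster (zdGraph 2) O w₁ = siteCluster (zdGraph 2) O w₂ := by
    intro w₁ w₂ c c' c'' hcc' hc'c'' hinf hc hc'' hc'
    obtain ⟨p, hp⟩ := exists_walk_of_mem_siteCluster hc hc''
    by_cases hmem : (![c', 0] : Site 2) ∈ (p.mapLe zdGraph_le_zdStarGraph).support
    · rw [Walk.support_mapLe_eq_support] at hmem
      exact siteCluster_eq_of_mem (mem_siteCluster_of_mem_support hc p hp hmem) hc'
    rcases finite_or_meets_of_between hcc' hc'c'' (p.mapLe zdGraph_le_zdStarGraph)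
      (fun z hz => by rw [Walk.support_mapLe_eq_support] at hz; exact (hp z hz).2) hmem
      Set.inter_subset_right hc' with hfin | ⟨z, hz₂, hzp⟩
    · exact absurd hfin hinf
    · rw [Walk.support_mapLe_eq_support] at hzp
      exact siteCluster_eq_of_mem (mem_siteCluster_of_mem_support hc p hp hzp) hz₂
  -- the two clusters are on the same side of `D`
  obtain ⟨k₁, hk₁, -⟩ := exists_axis_far hC₁t 0
  obtain ⟨k₂, hk₂, -⟩ := exists_axis_far hC₂t 0
  rcases plusStar_minus_sides hD hC₁ ⟨k₁, hk₁⟩ with hL₁ | hR₁ <;>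
    rcases plusStar_minus_sides hD hC₂ ⟨k₂, hk₂⟩ with hL₂ | hR₂
  · -- both to the right of `D`: interlace going to `+∞`
    obtain ⟨a, ha, -⟩ := exists_axis_far hD 0
    have hfar₂ : ∀ n : ℤ, ∃ k, (![k, 0] : Site 2) ∈ siteCluster (zdGraph 2) O y₂ ∧ n < k := fun n => by
      obtain ⟨k, hk, hkn⟩ := exists_axis_far hC₂t (n.natAbs + a.natAbs)
      refine ⟨k, hk, ?_⟩
      have := hL₂ a k ha hk
      cases abs_cases k <;> omega
    have hfar₁ : ∀ n : ℤ, ∃ k, (![k, 0] : Site 2) ∈ siteCluster (zdGraph 2) O y₁ ∧ n < k := fun n => by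
      obtain ⟨k, hk, hkn⟩ := exists_axis_far hC₁t (n.natAbs + a.natAbs)
      refine ⟨k, hk, ?_⟩
      have := hL₁ a k ha hk
      cases abs_cases k <;> omega
    obtain ⟨c', hc', hk₁c'⟩ := hfar₂ k₁
    obtain ⟨c'', hc'', hc'c''⟩ := hfar₁ c'
    exact hcross hk₁c' hc'c'' hC₂ hk₁ hc'' hc'
  · -- `C₁` right of `D`, `C₂` left of `D`: then `D` has axis sites only between `k₂` and `k₁`
    exfalso
    obtain ⟨a, ha, han⟩ := exists_axis_far hD (k₁.natAbs + k₂.natAbs)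
    have h1 := hL₁ a k₁ ha hk₁
    have h2 := hR₂ a k₂ ha hk₂
    cases abs_cases a <;> omega
  · exfalso
    obtain ⟨a, ha, han⟩ := exists_axis_far hD (k₁.natAbs + k₂.natAbs)
    have h1 := hR₁ a k₁ ha hk₁
    have h2 := hL₂ a k₂ ha hk₂
    cases abs_cases a <;> omega
  · -- both to the left of `D`: interlace going to `-∞`
    obtain ⟨a, ha, -⟩ := exists_axis_far hD 0
    have hfar₂ : ∀ n : ℤ, ∃ k, (![k, 0] : Site 2) ∈ siteCluster (zdGraph 2) O y₂ ∧ k < n := fun n => by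
      obtain ⟨k, hk, hkn⟩ := exists_axis_far hC₂t (n.natAbs + a.natAbs)
      refine ⟨k, hk, ?_⟩
      have := hR₂ a k ha hk
      cases abs_cases k <;> omega
    have hfar₁ : ∀ n : ℤ, ∃ k, (![k, 0] : Site 2) ∈ siteCluster (zdGraph 2) O y₁ ∧ k < n := fun n => by
      obtain ⟨k, hk, hkn⟩ := exists_axis_far hC₁t (n.natAbs + a.natAbs)
      refine ⟨k, hk, ?_⟩
      have := hR₁ a k ha hk
      cases abs_cases k <;> omega
    obtain ⟨c', hc', hc'k₁⟩ := hfar₂ k₁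
    obtain ⟨c, hc, hcc'⟩ := hfar₁ c'
    exact hcross hcc' hc'k₁ hC₂ hc hk₁ hc'

/-- **Uniqueness of the infinite `+∗`cluster of the upper half-plane in the presence of an infinite
`-`cluster touching the axis outside every box** (Georgii–Higuchi 2000, Lemma 4.1, *Uniqueness*,
second case: "each infinite `+`cluster must meet the other half-line infinitely often. Hence, two such
`+`clusters must cross each other, and are thus identical"). [cite: GeorgiiHiguchi2000, Lemma 4.1 (proof, p. 11)] -/
theorem plusStar_cluster_unique {x₁ x₂ y : Site 2}
    (hD₁ : (siteCluster zdStarGraph (spinSites 1 ω ∩ halfPlane 0) x₁).Infinite)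
    (hD₁t : ∀ n : ℕ, ∃ z ∈ siteCluster zdStarGraph (spinSites 1 ω ∩ halfPlane 0) x₁, z 1 = 0 ∧ (n : ℤ) < |z 0|)
    (hD₂ : (siteCluster zdStarGraph (spinSites 1 ω ∩ halfPlane 0) x₂).Infinite)
    (hD₂t : ∀ n : ℕ, ∃ z ∈ siteCluster zdStarGraph (spinSites 1 ω ∩ halfPlane 0) x₂, z 1 = 0 ∧ (n : ℤ) < |z 0|)
    (hC : (siteCluster (zdGraph 2) (spinSites (-1) ω ∩ halfPlane 0) y).Infinite)
    (hCt : ∀ n : ℕ, ∃ z ∈ siteCluster (zdGraph 2) (spinSites (-1) ω ∩ halfPlane 0) y, z 1 = 0 ∧ (n : ℤ) < |z 0|) :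
    siteCluster zdStarGraph (spinSites 1 ω ∩ halfPlane 0) x₁ =
      siteCluster zdStarGraph (spinSites 1 ω ∩ halfPlane 0) x₂ := by
  have hD₁' := hD₁
  set O := spinSites 1 ω ∩ halfPlane 0 with hOdef
  -- crossing: interlaced axis sites `c < c' < c''` of `D₁, D₂, D₁` give a common site
  have hcross : ∀ {w₁ w₂ : Site 2} {c c' c'' : ℤ}, c < c' → c' < c'' →
      (siteCluster zdStarGraph O w₂).Infinite →
      (![c, 0] : Site 2) ∈ siteCluster zdStarGraph O w₁ → (![c'', 0] : Site 2) ∈ siteCluster zdStarGraph O w₁ →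
      (![c', 0] : Site 2) ∈ siteCluster zdStarGraph O w₂ →
      siteCluster zdStarGraph O w₁ = siteCluster zdStarGraph O w₂ := by
    intro w₁ w₂ c c' c'' hcc' hc'c'' hinf hc hc'' hc'
    obtain ⟨p, hp⟩ := exists_walk_of_mem_siteCluster hc hc''
    by_cases hmem : (![c', 0] : Site 2) ∈ p.support
    · exact siteCluster_eq_of_mem (mem_siteCluster_of_mem_support hc p hp hmem) hc'
    rcases finite_or_touches_of_between hcc' hc'c'' p (fun z hz => (hp z hz).2) hmem
      Set.inter_subset_right hc' with hfin | ⟨w, hwp, z', hz'₂, hwz'⟩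
    · exact absurd hfin hinf
    · have hw₁ : w ∈ siteCluster zdStarGraph O w₁ := mem_siteCluster_of_mem_support hc p hp hwp
      rcases hwz' with rfl | hadj
      · exact siteCluster_eq_of_mem hw₁ hz'₂
      · exact siteCluster_eq_of_mem (mem_siteCluster_of_adj hw₁ hz'₂.2.1 (zdGraph_le_zdStarGraph hadj)) hz'₂
  obtain ⟨k, hk, -⟩ := exists_axis_far hCt 0
  rcases plusStar_minus_sides hD₁t hC ⟨k, hk⟩ with hL₁ | hR₁ <;>
    rcases plusStar_minus_sides hD₂t hC ⟨k, hk⟩ with hL₂ | hR₂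
  · -- both to the left of `C`: unbounded below, interlace going to `-∞`
    have hfar : ∀ {w : Site 2}, (∀ n : ℕ, ∃ z ∈ siteCluster zdStarGraph O w, z 1 = 0 ∧ (n : ℤ) < |z 0|) →
        (∀ a k' : ℤ, (![a, 0] : Site 2) ∈ siteCluster zdStarGraph O w →
          (![k', 0] : Site 2) ∈ siteCluster (zdGraph 2) (spinSites (-1) ω ∩ halfPlane 0) y → a < k') →
        ∀ n : ℤ, ∃ a, (![a, 0] : Site 2) ∈ siteCluster zdStarGraph O w ∧ a < n := by
      intro w ht hL n
      obtain ⟨a, ha, han⟩ := exists_axis_far ht (n.natAbs + k.natAbs)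
      refine ⟨a, ha, ?_⟩
      have := hL a k ha hk
      cases abs_cases a <;> omega
    obtain ⟨d, hd, -⟩ := exists_axis_far hD₁t 0
    obtain ⟨d', hd', hd'd⟩ := hfar hD₂t hL₂ d
    obtain ⟨d'', hd'', hd''d'⟩ := hfar hD₁t hL₁ d'
    exact hcross hd''d' hd'd hD₂ hd'' hd hd'
  · -- `D₁` left of `C`, `D₂` right of `C`: the axis sites of `C` are trapped
    exfalso
    obtain ⟨a₁, ha₁, -⟩ := exists_axis_far hD₁t 0
    obtain ⟨a₂, ha₂, -⟩ := exists_axis_far hD₂t 0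
    obtain ⟨k', hk', hk'n⟩ := exists_axis_far hCt (a₁.natAbs + a₂.natAbs)
    have h1 := hL₁ a₁ k' ha₁ hk'
    have h2 := hR₂ a₂ k' ha₂ hk'
    cases abs_cases k' <;> omega
  · exfalso
    obtain ⟨a₁, ha₁, -⟩ := exists_axis_far hD₁t 0
    obtain ⟨a₂, ha₂, -⟩ := exists_axis_far hD₂t 0
    obtain ⟨k', hk', hk'n⟩ := exists_axis_far hCt (a₁.natAbs + a₂.natAbs)
    have h1 := hR₁ a₁ k' ha₁ hk'
    have h2 := hL₂ a₂ k' ha₂ hk'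
    cases abs_cases k' <;> omega
  · -- both to the right of `C`: unbounded above, interlace going to `+∞`
    have hfar : ∀ {w : Site 2}, (∀ n : ℕ, ∃ z ∈ siteCluster zdStarGraph O w, z 1 = 0 ∧ (n : ℤ) < |z 0|) →
        (∀ a k' : ℤ, (![a, 0] : Site 2) ∈ siteCluster zdStarGraph O w →
          (![k', 0] : Site 2) ∈ siteCluster (zdGraph 2) (spinSites (-1) ω ∩ halfPlane 0) y → k' < a) →
        ∀ n : ℤ, ∃ a, (![a, 0] : Site 2) ∈ siteCluster zdStarGraph O w ∧ n < a := by
      intro w ht hR n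
      obtain ⟨a, ha, han⟩ := exists_axis_far ht (n.natAbs + k.natAbs)
      refine ⟨a, ha, ?_⟩
      have := hR a k ha hk
      cases abs_cases a <;> omega
    obtain ⟨d, hd, -⟩ := exists_axis_far hD₁t 0
    obtain ⟨d', hd', hdd'⟩ := hfar hD₂t hR₂ d
    obtain ⟨d'', hd'', hd'd''⟩ := hfar hD₁t hR₁ d'
    exact hcross hdd' hd'd'' hD₂ hd hd'' hd'

end Unique

/-! ### Almost surely -/

section AlmostSure

variable {β : ℝ} {G : SimpleGraph (Site 2)} {μ : Measure (SpinConfig (Site 2))}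

/-- **Line touching for `-`clusters**: for `β > β_c(2)` and every `μ ∈ 𝒢(β, 0)`, almost surely every
infinite `-`cluster of the upper half-plane (for any graph `G` between the lattice and the `∗`-graph)
contains axis sites outside every box — the tree's `ae_infinite_cluster_touches_axis_io` for the
spin-flipped measure `μ ∘ T⁻¹ ∈ 𝒢(β, 0)` ("any result proved for the `+`sign is also valid with the
`-`sign", Georgii–Higuchi 2000, proof of Lemma 4.1). [cite: GeorgiiHiguchi2000, Lemma 4.1] -/
theorem ae_minus_touches_axis_io [G.LocallyFinite] (hβc : criticalBeta 2 < β) (hnn : zdGraph 2 ≤ G)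
    (hst : G ≤ zdStarGraph) (hμ : μ ∈ isingGibbsMeasures 2 β 0) :
    ∀ᵐ ω ∂μ, ∀ x, (siteCluster G (spinSites (-1) ω ∩ halfPlane 0) x).Infinite →
      ∀ n : ℕ, ∃ y ∈ siteCluster G (spinSites (-1) ω ∩ halfPlane 0) x, y 1 = 0 ∧ (n : ℤ) < |y 0| := by
  have hμG : IsGibbsMeasure (isingSpecification (zdGraph 2) β 0) μ := hμ
  have hμ' : (μ.map fun σ : SpinConfig (Site 2) => -σ) ∈ isingGibbsMeasures 2 β 0 :=
    isGibbsMeasure_map_neg (zdGraph 2) β hμG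
  have h := ae_infinite_cluster_touches_axis_io (G := G) hβc hnn hst hμ'
  have h2 := ae_of_ae_map (measurable_neg.aemeasurable) h
  filter_upwards [h2] with ω hω
  simpa only [spinSites_neg_config, neg_neg] using hω

/-- **Sides, almost surely** (the set-up of Georgii–Higuchi 2000, §5): for `β > β_c(2)` and every
`μ ∈ 𝒢(β, 0)`, almost surely, for every infinite `+∗`cluster `D` and every infinite `-`cluster `C` of the
upper half-plane, the axis sites of `D` all lie strictly to the left of those of `C`, or all strictly to
the right. [cite: GeorgiiHiguchi2000, Lemma 5.3 (proof, p. 13)] -/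
theorem ae_plusStar_minus_sides (hβc : criticalBeta 2 < β) (hμ : μ ∈ isingGibbsMeasures 2 β 0) :
    ∀ᵐ ω ∂μ, ∀ x y, (siteCluster zdStarGraph (spinSites 1 ω ∩ halfPlane 0) x).Infinite →
      (siteCluster (zdGraph 2) (spinSites (-1) ω ∩ halfPlane 0) y).Infinite →
      (∀ a k : ℤ, (![a, 0] : Site 2) ∈ siteCluster zdStarGraph (spinSites 1 ω ∩ halfPlane 0) x →
          (![k, 0] : Site 2) ∈ siteCluster (zdGraph 2) (spinSites (-1) ω ∩ halfPlane 0) y → a < k) ∨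
        (∀ a k : ℤ, (![a, 0] : Site 2) ∈ siteCluster zdStarGraph (spinSites 1 ω ∩ halfPlane 0) x →
          (![k, 0] : Site 2) ∈ siteCluster (zdGraph 2) (spinSites (-1) ω ∩ halfPlane 0) y → k < a) := by
  filter_upwards [ae_infinite_cluster_touches_axis_io (G := zdStarGraph) hβc zdGraph_le_zdStarGraph le_rfl hμ,
    ae_minus_touches_axis_io (G := zdGraph 2) hβc le_rfl zdGraph_le_zdStarGraph hμ] with ω hD hC x y hDx hCy
  obtain ⟨k, hk, -⟩ := exists_axis_far (hC y hCy) 0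
  exact plusStar_minus_sides (hD x hDx) hCy ⟨k, hk⟩

/-- **Uniqueness of the infinite `-`cluster of the upper half-plane, almost surely, when an infinite
`+∗`cluster exists** (Georgii–Higuchi 2000, Lemma 4.1, first statement, in the coexistence case of §5). [cite: GeorgiiHiguchi2000, Lemma 4.1] -/
theorem ae_minus_cluster_unique (hβc : criticalBeta 2 < β) (hμ : μ ∈ isingGibbsMeasures 2 β 0) :
    ∀ᵐ ω ∂μ, ∀ x y₁ y₂, (siteCluster zdStarGraph (spinSites 1 ω ∩ halfPlane 0) x).Infinite →
      (siteCluster (zdGraph 2) (spinSites (-1) ω ∩ halfPlane 0) y₁).Infinite →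
      (siteCluster (zdGraph 2) (spinSites (-1) ω ∩ halfPlane 0) y₂).Infinite →
      siteCluster (zdGraph 2) (spinSites (-1) ω ∩ halfPlane 0) y₁ =
        siteCluster (zdGraph 2) (spinSites (-1) ω ∩ halfPlane 0) y₂ := by
  filter_upwards [ae_infinite_cluster_touches_axis_io (G := zdStarGraph) hβc zdGraph_le_zdStarGraph le_rfl hμ,
    ae_minus_touches_axis_io (G := zdGraph 2) hβc le_rfl zdGraph_le_zdStarGraph hμ] with ω hD hC x y₁ y₂ hDx hC₁ hC₂
  exact minus_cluster_unique (hD x hDx) hC₁ (hC y₁ hC₁) hC₂ (hC y₂ hC₂)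

/-- **Uniqueness of the infinite `+∗`cluster of the upper half-plane, almost surely, when an infinite
`-`cluster exists** (Georgii–Higuchi 2000, Lemma 4.1, first statement, in the coexistence case of §5). [cite: GeorgiiHiguchi2000, Lemma 4.1] -/
theorem ae_plusStar_cluster_unique (hβc : criticalBeta 2 < β) (hμ : μ ∈ isingGibbsMeasures 2 β 0) :
    ∀ᵐ ω ∂μ, ∀ x₁ x₂ y, (siteCluster zdStarGraph (spinSites 1 ω ∩ halfPlane 0) x₁).Infinite →
      (siteCluster zdStarGraph (spinSites 1 ω ∩ halfPlane 0) x₂).Infinite →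
      (siteCluster (zdGraph 2) (spinSites (-1) ω ∩ halfPlane 0) y).Infinite →
      siteCluster zdStarGraph (spinSites 1 ω ∩ halfPlane 0) x₁ =
        siteCluster zdStarGraph (spinSites 1 ω ∩ halfPlane 0) x₂ := by
  filter_upwards [ae_infinite_cluster_touches_axis_io (G := zdStarGraph) hβc zdGraph_le_zdStarGraph le_rfl hμ,
    ae_minus_touches_axis_io (G := zdGraph 2) hβc le_rfl zdGraph_le_zdStarGraph hμ] with ω hD hC x₁ x₂ y hD₁ hD₂ hCy
  exact plusStar_cluster_unique hD₁ (hD x₁ hD₁) hD₂ (hD x₂ hD₂) hCy (hC y hCy)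

end AlmostSure

end Literature.Probability.LatticeModels
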